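import Summits.RiemannHypothesis.RiemannHypothesis.Theorems.WeilBochnerMeasureCounting
import HarnessLib

/-!
# RiemannHypothesis — the counting law is UNIFORM over all representing measures of a window

Helper file (`--supports stmt-RiemannHypothesis-0098`), RH-free, standard axioms.  Seat rh-explicit
weil-3 (structure).

`WeilBochnerMeasureCounting.lean` proves, for each measure `μ` representing Weil's form on `[-b, b]`,
a constant `C` with `|μ[0, T] − θ(T)/π| ≤ C (1 + log(1 + T))`.  Inspection of the proof shows that `C`
comes from the WEIL SIDE only (Selberg's kernels of bandwidth `min b (log 2)/2π` and
`exists_weil_side_bound`), so it does not depend on `μ`.  This file records the uniform statements: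

* `exists_uniform_countingLaw_const`: for `b > 0` there is ONE `C = C(b)` such that EVERY measure
  representing Weil's form on `[-b, b]` satisfies `|μ[0,T] − θ(T)/π| ≤ C(1 + log(1+T))` and
  `|μ[-T,0] − θ(T)/π| ≤ C(1 + log(1+T))` for all `T ≥ 0`;
* `exists_uniform_countingLaw_const_of_le`: the same `C(b₀)` serves every window `b ≥ b₀` (a measure
  representing the form on `[-b, b]` represents it on `[-b₀, b₀]`).

So the family of all spectral measures of all rungs `b ≥ b₀` is uniformly Riemann–von Mangoldt: the
representing measures of a window form a set of positive measures with a common counting function up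
to `O(log T)` — the structural input for compactness / extremal arguments across the ladder.
-/

noncomputable section

set_option linter.dupNamespace false  -- the mandated namespace repeats `RiemannHypothesis`

open Complex Filter Set MeasureTheory
open scoped Real Topology ContDiff ComplexConjugate
open Literature.NumberTheory.LFunctions Literature.Analysis.Fourier Literature.Analysis.SpecialFunctions

namespace Summit.RiemannHypothesis.RiemannHypothesis.Theorems.WeilBochnerMeasure

variable {b : ℝ}

/-- **Uniform counting law on `[0, T]`.**  For `b > 0` there is `C` such that every measure
representing Weil's form on `[-b, b]` satisfies `|μ[0, T] − θ(T)/π| ≤ C (1 + log(1 + T))` for all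
`T ≥ 0` (the proof of `abs_measureReal_Icc_zero_sub_theta_le` with the constant chosen before `μ`). -/
theorem exists_uniform_countingLaw_const_half (hb : 0 < b) :
    ∃ C : ℝ, ∀ μ : Measure ℝ,
      (∀ g : ℝ → ℂ, IsWeilTest g → tsupport g ⊆ Icc (-b) b →
        Integrable (fun t : ℝ ↦ ‖weilMellin g (1 / 2 + t * I)‖ ^ 2) μ ∧
          weilQuadratic g = ((∫ t, ‖weilMellin g (1 / 2 + t * I)‖ ^ 2 ∂μ : ℝ) : ℂ)) →
      ∀ T : ℝ, 0 ≤ T →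
        |μ.real (Icc 0 T) - riemannSiegelTheta T / π| ≤ C * (1 + Real.log (1 + T)) := by
  -- bandwidth `2πΔ = c = min b (log 2)`
  set c : ℝ := min b (Real.log 2) with hc
  have hc0 : 0 < c := lt_min hb (Real.log_pos one_lt_two)
  have hcb : c ≤ b := min_le_left _ _
  have hc2 : c ≤ Real.log 2 := min_le_right _ _
  have hclt : c < 2 * b := by linarith
  set Δ : ℝ := c / (2 * π) with hΔ
  have hΔ0 : 0 < Δ := by positivity
  have h2πΔ : 2 * π * Δ = c := by
    rw [hΔ]; field_simp
  obtain ⟨A, B, hAB⟩ := exists_weil_side_bound hΔ0 (by rw [h2πΔ]; exact hc2)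
  refine ⟨max A B, fun μ hμ T hT ↦ ?_⟩
  obtain ⟨gp, gm, hgpc, hgmc, hgps, hgms, hgpM, hgmM, hgp0, hgm0⟩ := exists_selberg_kernels hΔ0 hT
  -- Weil side
  have hp := hAB T hT gp hgpc hgps (Or.inl ⟨hgpM, hgp0⟩)
  have hm := hAB T hT gm hgmc hgms (Or.inr ⟨hgmM, hgm0⟩)
  rw [h2πΔ] at hgps hgms
  -- real transforms on the line
  set Fp : ℝ → ℝ := selbergMajorantReal Δ 0 T with hFp
  set Fm : ℝ → ℝ := selbergMinorantReal Δ 0 T with hFm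
  have hgp_line : ∀ u : ℝ, weilMellin gp (1 / 2 + u * I) = (Fp u : ℂ) := fun u ↦ by
    rw [hgpM, selbergMajorant_ofReal]
  have hgm_line : ∀ u : ℝ, weilMellin gm (1 / 2 + u * I) = (Fm u : ℂ) := fun u ↦ by
    rw [hgmM, selbergMinorant_ofReal]
  have hgpcs : HasCompactSupport gp := isCompact_Icc.of_isClosed_subset (isClosed_tsupport _) hgps
  have hgmcs : HasCompactSupport gm := isCompact_Icc.of_isClosed_subset (isClosed_tsupport _) hgms
  -- quadratic decay of the transforms
  obtain ⟨Kp, hKp0, hKp⟩ := exists_norm_selbergMajorant_le hΔ0 0 T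
  obtain ⟨Km, hKm0, hKm⟩ := exists_norm_selbergMinorant_le hΔ0 0 T
  have hdecp : ∀ u : ℝ, ‖weilMellin gp (1 / 2 + u * I)‖ ≤ Kp * (1 + 2 * (1 + T ^ 2)) / (1 + u ^ 2) :=
    fun u ↦ by
      rw [hgpM]
      have h := hKp u
      simp only [Complex.ofReal_im, abs_zero, mul_zero, Real.exp_zero, mul_one, Complex.ofReal_re] at h
      exact h.trans (profile_le_div hKp0.le)
  have hdecm : ∀ u : ℝ, ‖weilMellin gm (1 / 2 + u * I)‖ ≤ Km * (1 + 2 * (1 + T ^ 2)) / (1 + u ^ 2) :=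
    fun u ↦ by
      rw [hgmM]
      have h := hKm u
      simp only [Complex.ofReal_im, abs_zero, mul_zero, Real.exp_zero, mul_one, Complex.ofReal_re] at h
      exact h.trans (profile_le_div hKm0.le)
  -- the difference kernel `hd = gp - gm`, transform `Fp - Fm ≥ 0`
  set hd : ℝ → ℂ := fun x ↦ gp x - gm x with hhd
  have hhdc : Continuous hd := hgpc.sub hgmc
  have hhds : tsupport hd ⊆ Icc (-c) c := by
    refine closure_minimal (fun x hx ↦ ?_) isClosed_Icc
    rw [Function.mem_support] at hx
    by_contra hxc
    have h1 : gp x = 0 := image_eq_zero_of_notMem_tsupport fun h ↦ hxc (hgps h)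
    have h2 : gm x = 0 := image_eq_zero_of_notMem_tsupport fun h ↦ hxc (hgms h)
    exact hx (by simp only [hhd, h1, h2, sub_zero])
  have hhdcs : HasCompactSupport hd := isCompact_Icc.of_isClosed_subset (isClosed_tsupport _) hhds
  have hsum : gm + hd = gp := by
    funext x; simp only [Pi.add_apply, hhd]; ring
  have hhd_line : ∀ u : ℝ, weilMellin hd (1 / 2 + u * I) = ((Fp u - Fm u : ℝ) : ℂ) := by
    intro u
    have h := weilMellin_add hgmc hgmcs hhdc hhdcs (1 / 2 + u * I)
    rw [hsum, hgp_line, hgm_line] at h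
    push_cast
    linear_combination -h
  have hdech : ∀ u : ℝ, ‖weilMellin hd (1 / 2 + u * I)‖ ≤
      (Kp + Km) * (1 + 2 * (1 + T ^ 2)) / (1 + u ^ 2) := by
    intro u
    have e : weilMellin hd (1 / 2 + u * I) =
        weilMellin gp (1 / 2 + u * I) - weilMellin gm (1 / 2 + u * I) := by
      rw [hhd_line, hgp_line, hgm_line]; push_cast; ring
    rw [e]
    calc ‖weilMellin gp (1 / 2 + u * I) - weilMellin gm (1 / 2 + u * I)‖
        ≤ ‖weilMellin gp (1 / 2 + u * I)‖ + ‖weilMellin gm (1 / 2 + u * I)‖ := norm_sub_le _ _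
      _ ≤ Kp * (1 + 2 * (1 + T ^ 2)) / (1 + u ^ 2) + Km * (1 + 2 * (1 + T ^ 2)) / (1 + u ^ 2) :=
          add_le_add (hdecp u) (hdecm u)
      _ = (Kp + Km) * (1 + 2 * (1 + T ^ 2)) / (1 + u ^ 2) := by ring
  -- signs: `Fm ≤ 𝟙_{[0,T]} ≤ Fp`
  set χ : ℝ → ℝ := (Icc 0 T).indicator (fun _ ↦ (1 : ℝ)) with hχ
  have hind_le : ∀ u, χ u ≤ Fp u := fun u ↦ indicator_le_selbergMajorantReal hΔ0 hT u
  have hle_ind : ∀ u, Fm u ≤ χ u := fun u ↦ selbergMinorantReal_le_indicator_Icc hΔ0 0 T u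
  have hχ0 : ∀ u, 0 ≤ χ u := fun u ↦ Set.indicator_nonneg (fun _ _ ↦ zero_le_one) u
  have hFp0 : ∀ u, 0 ≤ Fp u := fun u ↦ (hχ0 u).trans (hind_le u)
  have hFpm0 : ∀ u, 0 ≤ Fp u - Fm u := fun u ↦ by linarith [hind_le u, hle_ind u]
  -- measure side: `∫ Fp dμ = W(gp)`, `∫ (Fp - Fm) dμ = W(hd)`
  obtain ⟨hIp, hWp⟩ := weilFunctional_kernel_eq_integral hb hμ hgpc hclt hgps hdecp
    (fun u ↦ by rw [hgp_line]; exact ⟨Complex.ofReal_im _, by rw [Complex.ofReal_re]; exact hFp0 u⟩)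
  obtain ⟨hId, hWd⟩ := weilFunctional_kernel_eq_integral hb hμ hhdc hclt hhds hdech
    (fun u ↦ by rw [hhd_line]; exact ⟨Complex.ofReal_im _, by rw [Complex.ofReal_re]; exact hFpm0 u⟩)
  simp only [hgp_line, Complex.ofReal_re] at hIp hWp
  simp only [hhd_line, Complex.ofReal_re] at hId hWd
  -- `W(gp) = W(gm) + W(hd)`, hence `Re W(gm) = ∫ Fm dμ`
  have hAm := integrable_arch_of_decay hgmc hgmcs hdecm
  have hAd := integrable_arch_of_decay hhdc hhdcs hdech
  have hWadd : weilFunctional gp = weilFunctional gm + weilFunctional hd := by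
    rw [← hsum]; exact weilFunctional_add_of_continuous hgmc hgmcs hhdc hhdcs hAm hAd
  have hIm : Integrable Fm μ :=
    (hIp.sub hId).congr (ae_of_all _ fun t ↦ by simp only [Pi.sub_apply]; ring)
  have hWm_re : (weilFunctional gm).re = ∫ t, Fm t ∂μ := by
    have h : weilFunctional gm = weilFunctional gp - weilFunctional hd := by rw [hWadd]; ring
    rw [h, hWp, hWd, ← Complex.ofReal_sub, Complex.ofReal_re, ← integral_sub hIp hId]
    exact integral_congr_ae (ae_of_all _ fun t ↦ by ring)
  have hWp_re : (weilFunctional gp).re = ∫ t, Fp t ∂μ := by rw [hWp, Complex.ofReal_re]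
  -- the indicator is integrable and integrates to `μ[0, T]`
  have hχm : AEStronglyMeasurable χ μ :=
    (measurable_const.indicator measurableSet_Icc).aestronglyMeasurable
  have hχi : Integrable χ μ := hIp.mono' hχm (ae_of_all _ fun t ↦ by
    rw [Real.norm_eq_abs, abs_of_nonneg (hχ0 t)]; exact hind_le t)
  have hχint : ∫ t, χ t ∂μ = μ.real (Icc 0 T) := integral_indicator_one measurableSet_Icc
  -- squeeze
  have hup : μ.real (Icc 0 T) ≤ (weilFunctional gp).re := by
    rw [hWp_re, ← hχint]; exact integral_mono hχi hIp hind_le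
  have hlow : (weilFunctional gm).re ≤ μ.real (Icc 0 T) := by
    rw [hWm_re, ← hχint]; exact integral_mono hIm hχi hle_ind
  have hlogT : 0 ≤ Real.log (1 + T) := Real.log_nonneg (by linarith)
  have hA : A ≤ max A B := le_max_left _ _
  have hB : B * Real.log (1 + T) ≤ max A B * Real.log (1 + T) :=
    mul_le_mul_of_nonneg_right (le_max_right _ _) hlogT
  rw [abs_le] at hp hm ⊢
  constructor <;> nlinarith [hp.1, hp.2, hm.1, hm.2]


/-- **Uniform counting law (both half-lines).**  For `b > 0` there is ONE constant `C` such that EVERY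
measure `μ` representing Weil's form on `[-b, b]` satisfies, for all `T ≥ 0`,
`|μ[0, T] − θ(T)/π| ≤ C (1 + log(1 + T))` and `|μ[-T, 0] − θ(T)/π| ≤ C (1 + log(1 + T))`
(the reflected measure represents the same form, `represents_map_neg`). -/
theorem exists_uniform_countingLaw_const (hb : 0 < b) :
    ∃ C : ℝ, ∀ μ : Measure ℝ,
      (∀ g : ℝ → ℂ, IsWeilTest g → tsupport g ⊆ Icc (-b) b →
        Integrable (fun t : ℝ ↦ ‖weilMellin g (1 / 2 + t * I)‖ ^ 2) μ ∧
          weilQuadratic g = ((∫ t, ‖weilMellin g (1 / 2 + t * I)‖ ^ 2 ∂μ : ℝ) : ℂ)) →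
      ∀ T : ℝ, 0 ≤ T →
        |μ.real (Icc 0 T) - riemannSiegelTheta T / π| ≤ C * (1 + Real.log (1 + T)) ∧
          |μ.real (Icc (-T) 0) - riemannSiegelTheta T / π| ≤ C * (1 + Real.log (1 + T)) := by
  obtain ⟨C, hC⟩ := exists_uniform_countingLaw_const_half hb
  refine ⟨C, fun μ hμ T hT ↦ ⟨hC μ hμ T hT, ?_⟩⟩
  have h := hC _ (represents_map_neg hμ) T hT
  rwa [map_neg_measureReal_Icc] at h

/-- **Uniformity across the ladder.**  The constant of the window `b₀ > 0` serves every window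
`b ≥ b₀`: all spectral measures of all rungs `b ≥ b₀` obey the same two-sided counting law. -/
theorem exists_uniform_countingLaw_const_of_le {b₀ : ℝ} (hb₀ : 0 < b₀) :
    ∃ C : ℝ, ∀ b : ℝ, b₀ ≤ b → ∀ μ : Measure ℝ,
      (∀ g : ℝ → ℂ, IsWeilTest g → tsupport g ⊆ Icc (-b) b →
        Integrable (fun t : ℝ ↦ ‖weilMellin g (1 / 2 + t * I)‖ ^ 2) μ ∧
          weilQuadratic g = ((∫ t, ‖weilMellin g (1 / 2 + t * I)‖ ^ 2 ∂μ : ℝ) : ℂ)) →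
      ∀ T : ℝ, 0 ≤ T →
        |μ.real (Icc 0 T) - riemannSiegelTheta T / π| ≤ C * (1 + Real.log (1 + T)) ∧
          |μ.real (Icc (-T) 0) - riemannSiegelTheta T / π| ≤ C * (1 + Real.log (1 + T)) := by
  obtain ⟨C, hC⟩ := exists_uniform_countingLaw_const hb₀
  refine ⟨C, fun b hb μ hμ ↦ hC μ fun g hg hgs ↦ hμ g hg (hgs.trans (Icc_subset_Icc ?_ hb))⟩
  linarith

end Summit.RiemannHypothesis.RiemannHypothesis.Theorems.WeilBochnerMeasure

end
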